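import Summits.BirchSwinnertonDyer.BirchSwinnertonDyer.Theorems.ErratumRoadFiveNonSurjCornerKolyJProp44OfFrobeniusCongruence
import Summits.BirchSwinnertonDyer.Rank1Residual.X10.LeafDischargeX10bKolyvaginOdd
import Summits.BirchSwinnertonDyer.Rank1Residual.X10.LeafDischargeX10b
import HarnessLib

/-!
# Class X10b: the DISCHARGE INTERFACE for the (γ) input of the Prop. 4.4 / 4.7 chain AT `p = 3` —
# Gross 1991 Prop. 3.7 (2) BY NAME on frames with `d_K ≡ 1 (mod 8)` (the rev-3b binder of J₃)

Print-tier cell `bsd-print-x9` (D-0131 (2), key `x9`), typer seat ty2, file O of the interface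
(X10b companion of files I/M). Theorems only: no definition, no new named fact (D-0014 / D-0026); every
theorem is CONDITIONAL on the one published, typed, image-free fact
`(h : GrossLMS1991.prop37_2_frobeniusCongruence)` (Gross 1991 Prop. 3.7 (2) = Nekovář 2007 Prop. 4.13 (ii),
the (γ) head of crux J = 20392 / J₃ = stmt-21340); nothing is asserted about any curve.

WHY THIS FILE. The (γ) supplier of the corner-p1 chain (cell `bsd-stepL`,
`Theorems/ErratumRoadFiveNonSurjCornerKolyJProp44OfFrobeniusCongruence`) — consumed by p4's
`JET.Split.coreVertexExistenceX9_of_namedFacts` (`Theorems/PrintX9JetchevX9CoreVertexExistence`, l.124: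
`Prop44.exists_data_h47Base_of_frobeniusCongruence_of_irr h37 … hp3 …`) — carries `hp3 : p ≠ 3` for ONE
reason: Nekovář's print edge `ℓ ≠ 2` in `prop37_2_frobeniusCongruence.reductionCongruence_pair`, automatic
for a Zhang–Kolyvagin prime when `p ≠ 3` (`Prop44.ne_two_of_isKolyvaginPrime_of_ne_three`) and NOT at
`p = 3` (`ℓ = 2` is Kolyvagin iff `2 ∤ N`, `2` inert, `3 ∣ a₂`). The J₃ crux of route `PrintX10b`
(`Theses.PrintX10b.HeegnerDivisibilityX10b`, item stmt-BirchSwinnertonDyer-21340, rev 3b) lives on Heegner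
frames with **`NumberField.discr K % 8 = 1`**, where `2` SPLITS in `K`, so NO prime `ℓ` with `(ℓ) ⊂ 𝓞_K`
prime equals `2` (file M, `Rank1Residual.not_isPrime_span_two_of_discr_mod_eight_eq_one`). On such frames
the print edge is therefore discharged by the FRAME, for every `p` including `p = 3`, and — better than
a re-keyed copy of corner-p1's based-family construction — the `hγW`-keyed g10 theorem
`Prop44.exists_data_h47Base_of_congruence_of_irr` (`…Prop44WalkH47`), whose `hγW` binder quantifies
over pairs `(m, ℓ)` with `(ℓ)` prime in `𝓞_K` (not assumed Kolyvagin), is fed DIRECTLY from the named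
fact. This file performs that keying:

* `Prop44.discr_lt_neg_four_of_discr_mod_eight_eq_one` — `d_K ≡ 1 (mod 8)`, `d_K < 0` ⟹ `d_K < −4`
  (so `d_K ≠ −3, −4`: `𝓞_Kˣ = {±1}`, the standing `hD` of the chain).
* `Prop44.congruenceW_of_frobeniusCongruence_of_discr_mod_eight_eq_one` — the `hγW` supplier of
  `exists_data_h47Base_of_congruence_of_irr` from `h` on a `d_K ≡ 1 (mod 8)` frame (any `p`).
* `Prop44.congruence_pair_of_frobeniusCongruence_of_discr_mod_eight_eq_one` — the per-pair `hγ`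
  supplier of the g10 any-pair theorems (`…Prop44AnyPair`) at Zhang–Kolyvagin levels, `hp3 ↦ hd8`.
* **`Prop44.exists_data_h47Base_of_frobeniusCongruence_of_discr_mod_eight_eq_one`** — conclusion
  VERBATIM that of corner-p1's `exists_data_h47Base_of_frobeniusCongruence_of_irr` (the based data
  family with Prop. 4.7 along increasing prime chains), binders `hp2, hHp, hirr, hd8` — NO `p ≠ 3`,
  NO `d_K < −4` (derived). This is the call the J₃ twin of `coreVertexExistenceX9_of_namedFacts` makes
  at l.124.
* `Prop44.localOrder_kolyvaginClass_mul_eq_…`, `addOrderOf_localization_kolyvaginClass_mul_eq_…`,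
  `kolyvaginClass_mul_mem_torsionLocalKer_iff_…` (`_of_frobeniusCongruence_of_irr_of_discr_mod_eight_eq_one`)
  — the three any-pair consumers (the walk's `h47`, the swap's `h44c`) likewise re-keyed.
* `ClassX10.exists_data_h47Base_of_heegner_of_discr_mod_eight_eq_one`,
  `ClassX10.addOrderOf_localization_kolyvaginClass_mul_eq_of_heegner_of_discr_mod_eight_eq_one` — the
  leaf forms at `p = 3` (`ClassX10 W p`: `hp2`, `hirr` from the class; frame: `IsImaginaryQuadratic K`,
  Heegner hypothesis for `N_E`, `3` split, `d_K ≡ 1 (mod 8)`).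

At `p ≠ 3` nothing changes (corner-p1's `hp3` versions); p4's own `JET.Split` Prop. 4.7 bricks
(`PrintX9JetchevSplitProp47`) already take `hl2 : ℓ ≠ 2` per prime and are fed at `3` by file M's
`ne_two_of_zhangKolyvaginPrime_of_heegner_of_discr_mod_eight_eq_one`.

Decl namespaces: `Summit.BirchSwinnertonDyer.BirchSwinnertonDyer.Theorems.Prop44` for the re-keyed
suppliers (next to corner-p1's), `Literature.NumberTheory.EllipticCurves.Rank1Residual` for the
`ClassX10.*` leaf forms (dot notation on the census predicate, as in files A–N).

## References (locators only; the statement used is the tree's named fact)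

* [GrossLMS1991] B. H. Gross, Kolyvagin's work on modular elliptic curves, LMS LNS 153 (1991): §3 (3.1)
  (Kolyvagin primes: `ℓ ∤ N·d_K·p`, inert), Prop. 3.7 (2) (p. 240), §4 (4.1).
* [Nekovar2007] J. Nekovář, The Euler system method for CM points on Shimura curves, LMS LNS 320 (2007):
  Prop. 4.13 (ii) (the congruence away from `I₀ ∋ 2`), (4.3).
* [McCallumLMS1991] W. G. McCallum, Kolyvagin's work on Shafarevich–Tate groups, LMS LNS 153 (1991): §4
  Prop. 4.4 (p. 301).
* [Jetchev2008] D. Jetchev, Compos. Math. 144 (2008): Prop. 4.4 (p. 821) (= arXiv Prop. 4.7).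
* [WZhang2014] W. Zhang, Camb. J. Math. 2 (2014): Notations (xii) (Kolyvagin primes).
* [Marcus2018] D. Marcus, Number Fields, Ch. 3 Thm. 25 (`2` splits in `K` iff `d_K ≡ 1 (mod 8)`).
-/

set_option autoImplicit false
set_option linter.dupNamespace false -- `Summit.BirchSwinnertonDyer.BirchSwinnertonDyer` (summit = problem), tree-wide

noncomputable section

open scoped Classical
open WeierstrassCurve Field NumberField IsDedekindDomain
open Literature.NumberTheory.EllipticCurves Literature.NumberTheory.GaloisRepresentations
open Literature.NumberTheory.EllipticCurves.KolyvaginCocycle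
open Literature.NumberTheory.EllipticCurves.RingClassField
open Literature.NumberTheory.EllipticCurves.ModularForms
open Literature.NumberTheory.GaloisCohomology
open Summit.BirchSwinnertonDyer.Rank1Residual.X11b
open Summit.BirchSwinnertonDyer.Rank1Residual.JET Summit.BirchSwinnertonDyer.Rank1Residual.X11b.Three.Koly

namespace Summit.BirchSwinnertonDyer.BirchSwinnertonDyer.Theorems.Prop44

open Literature.NumberTheory.EllipticCurves.Rank1Residual
  (not_isPrime_span_two_of_discr_mod_eight_eq_one ne_two_of_zhangKolyvaginPrime_of_discr_mod_eight_eq_one)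

variable {K : Type} [Field K] [NumberField K] {W : WeierstrassCurve ℚ} [W.IsElliptic] [W.IsGloballyMinimal]
  [NeZero (W.conductorNorm ℤ)]

/-! ### 1. The frame: `d_K ≡ 1 (mod 8)` -/

/-- **`d_K ≡ 1 (mod 8)` and `d_K < 0` ⟹ `d_K < −4`** (`d_K ∈ {−7, −15, −23, …}`): the standing `hD` of the
chain (`𝓞_Kˣ = {±1}`, i.e. `d_K ≠ −3, −4`) is automatic on the rev-3b frames. [folklore] -/
theorem discr_lt_neg_four_of_discr_mod_eight_eq_one (hK : IsImaginaryQuadratic K)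
    (hd8 : NumberField.discr K % 8 = 1) : NumberField.discr K < -4 := by
  have hneg : NumberField.discr K < 0 := hK.discr_neg
  omega

/-! ### 2. The (γ) suppliers BY NAME of Gross Prop. 3.7 (2) on a `d_K ≡ 1 (mod 8)` frame -/

/-- **The `hγW` supplier of `Prop44.exists_data_h47Base_of_congruence_of_irr`, from the named fact, on a
frame with `d_K ≡ 1 (mod 8)`** (any `p`): for every pair of levels `(mℓ, m)` with `mℓ` square-free and
prime to `N_E` and `(ℓ) ⊂ 𝓞_K` prime, the congruence `red(γ·y(mℓ)) = φ₀ • red(γ·(y(m) ↑ K[mℓ]))`. Nekovář's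
clause `ℓ ≠ 2` holds because `2` splits in `K` (file M). CONDITIONAL on the fact.
[cite: GrossLMS1991, Prop. 3.7 (2) (p. 240)] [cite: Nekovar2007, Prop. 4.13 (ii)] [cite: Marcus2018, Ch. 3 Thm. 25] -/
theorem congruenceW_of_frobeniusCongruence_of_discr_mod_eight_eq_one
    (h : GrossLMS1991.prop37_2_frobeniusCongruence) (hK : IsImaginaryQuadratic K)
    (hH : SatisfiesHeegnerHypothesis (W.conductorNorm ℤ) K) (hd8 : NumberField.discr K % 8 = 1) :
    ∀ (Dt : ModularParametrizationData W (W.conductorNorm ℤ)) (β : ℤ) (ι : K →+* ℂ)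
      (m ℓ : ℕ), Squarefree (m * ℓ) → ℓ.Prime → ¬ ℓ ∣ m →
      (∀ q ∈ (m * ℓ).primeFactors, ¬ q ∣ W.conductorNorm ℤ) →
      ¬ ((ℓ : ℤ) ∣ NumberField.discr K) → (Ideal.span {(ℓ : 𝓞 K)}).IsPrime →
      ∀ (d' : KolyvaginHeegnerData Dt β ι (m * ℓ)) (d : KolyvaginHeegnerData Dt β ι m)
        [Fact ℓ.Prime] (hΔ : ¬ (ℓ : ℤ) ∣ minimalDiscriminantInt W) (φ₀ : absoluteGaloisGroup (ZMod ℓ)),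
        (∀ x : AlgebraicClosure (ZMod ℓ), φ₀ • x = x ^ ℓ) →
        ∀ (hle : ringClassField K ι m ≤ ringClassField K ι (m * ℓ))
          (γ : ringClassField K ι (m * ℓ) ≃ₐ[ℚ] ringClassField K ι (m * ℓ)), γ ∈ ringClassGal ι (m * ℓ) →
          geomReduction hΔ ((RatClosure.pointsEquiv (K := K) W).symm
              (d'.toGeomPoints (pointGalHom W (ringClassField K ι (m * ℓ)) γ d'.y))) =
            φ₀ • geomReduction hΔ ((RatClosure.pointsEquiv (K := K) W).symm
              (d'.toGeomPoints (pointGalHom W (ringClassField K ι (m * ℓ)) γ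
                (WeierstrassCurve.Affine.Point.map (W' := W)
                  (letI : Algebra K ℂ := ι.toAlgebra; (RingClassField.inclusion ι hle).restrictScalars ℚ)
                  d.y)))) := by
  intro Dt β ι m ℓ hsq _hℓ _hℓm hN _hℓd hinert d' d _ hΔ φ₀ hφ₀ hle γ _
  have hD := discr_lt_neg_four_of_discr_mod_eight_eq_one hK hd8
  have hD3 : NumberField.discr K ≠ -3 := by omega
  have hD4 : NumberField.discr K ≠ -4 := by omega
  -- the print edge `ℓ ≠ 2`: `(2)` is not prime in `𝓞_K` when `d_K ≡ 1 (mod 8)`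
  have hℓ2 : ℓ ≠ 2 := by
    rintro rfl
    exact not_isPrime_span_two_of_discr_mod_eight_eq_one hK.1 hd8 (by exact_mod_cast hinert)
  have hcop : Nat.Coprime (m * ℓ) (W.conductorNorm ℤ) :=
    (KolyvaginH37Bridge.coprime_of_forall_not_dvd hsq.ne_zero hN).symm
  exact h.reductionCongruence_pair (N := W.conductorNorm ℤ) rfl hK ⟨hD3, hD4⟩ hH m ℓ hsq hcop
    (Or.inl hℓ2) hinert d' d hΔ hφ₀ hle γ

/-- **(γ) at a pair of Zhang–Kolyvagin levels `(mℓ, m)` on a `d_K ≡ 1 (mod 8)` frame, BY NAME of Gross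
Prop. 3.7 (2)** — the per-pair `hγ` binder of the g10 any-pair theorems (`…Prop44AnyPair`), for every `p`
(at `p = 3` included): corner-p1's `congruence_pair_of_frobeniusCongruence` with `hp3` replaced by `hd8`
(a Zhang–Kolyvagin prime is inert, hence `≠ 2` on such a frame:
`ne_two_of_zhangKolyvaginPrime_of_discr_mod_eight_eq_one`). CONDITIONAL on the fact.
[cite: GrossLMS1991, Prop. 3.7 (2) (p. 240)] [cite: Nekovar2007, Prop. 4.13 (ii)] [cite: WZhang2014, Notations (xii)] -/
theorem congruence_pair_of_frobeniusCongruence_of_discr_mod_eight_eq_one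
    (h : GrossLMS1991.prop37_2_frobeniusCongruence) (hK : IsImaginaryQuadratic K)
    (hH : SatisfiesHeegnerHypothesis (W.conductorNorm ℤ) K) (hd8 : NumberField.discr K % 8 = 1)
    {p : ℕ} [Fact p.Prime] {Dt : ModularParametrizationData W (W.conductorNorm ℤ)} {β : ℤ} {ι : K →+* ℂ}
    {m l : ℕ} (hsq : Squarefree (m * l)) (hl : l.Prime)
    (hS : ∀ l' ∈ (m * l).primeFactors, Zhang2014.IsKolyvaginPrime (W.conductorNorm ℤ) W K p l')
    (d₁ : KolyvaginHeegnerData Dt β ι (m * l)) (d₀ : KolyvaginHeegnerData Dt β ι m)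
    [Fact l.Prime] (hΔ : ¬ (l : ℤ) ∣ minimalDiscriminantInt W)
    (φ₀ : absoluteGaloisGroup (ZMod l)) (hφ₀ : ∀ x : AlgebraicClosure (ZMod l), φ₀ • x = x ^ l)
    (hle : ringClassField K ι m ≤ ringClassField K ι (m * l))
    (γ : ringClassField K ι (m * l) ≃ₐ[ℚ] ringClassField K ι (m * l)) :
    geomReduction hΔ ((RatClosure.pointsEquiv (K := K) W).symm
        (d₁.toGeomPoints (pointGalHom W (ringClassField K ι (m * l)) γ d₁.y))) =
      φ₀ • geomReduction hΔ ((RatClosure.pointsEquiv (K := K) W).symm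
        (d₁.toGeomPoints (pointGalHom W (ringClassField K ι (m * l)) γ
          (WeierstrassCurve.Affine.Point.map (W' := W)
            (letI : Algebra K ℂ := ι.toAlgebra; (RingClassField.inclusion ι hle).restrictScalars ℚ)
            d₀.y)))) := by
  have hD := discr_lt_neg_four_of_discr_mod_eight_eq_one hK hd8
  have hD3 : NumberField.discr K ≠ -3 := by omega
  have hD4 : NumberField.discr K ≠ -4 := by omega
  have hn0 : m * l ≠ 0 := hsq.ne_zero
  have hKol : Zhang2014.IsKolyvaginPrime (W.conductorNorm ℤ) W K p l :=
    hS l (Nat.mem_primeFactors.mpr ⟨hl, dvd_mul_left l m, hn0⟩)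
  have hcop : Nat.Coprime (m * l) (W.conductorNorm ℤ) :=
    (KolyvaginH37Bridge.coprime_of_forall_not_dvd hn0 fun q hq ↦ (hS q hq).2.1).symm
  exact h.reductionCongruence_pair (N := W.conductorNorm ℤ) rfl hK ⟨hD3, hD4⟩ hH m l hsq hcop
    (Or.inl (ne_two_of_zhangKolyvaginPrime_of_discr_mod_eight_eq_one _ W p hK.1 hd8 hKol))
    hKol.2.2.2.2.1 d₁ d₀ hΔ hφ₀ hle γ

/-! ### 3. The based data family with Prop. 4.7, `p = 3` allowed -/

/-- **`h47` of the based ordered walk on the IRREDUCIBLE cell, on a `d_K ≡ 1 (mod 8)` frame, ANY odd `p`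
split in `K` — BY NAME of Gross Prop. 3.7 (2).** Conclusion VERBATIM that of corner-p1's
`exists_data_h47Base_of_frobeniusCongruence_of_irr` (a data system `D` on the admissible-conductor
subtype through the given datum, with equal orders of the localisations of `c_k(sℓ)` and `c_k(s)` at
`λ ∋ ℓ` along every based ordered prime step); binders: `hp3 : p ≠ 3` REPLACED by
`hd8 : NumberField.discr K % 8 = 1`, and `hD : d_K < −4` derived. Proof: g10's `hγW`-keyed
`exists_data_h47Base_of_congruence_of_irr` with the supplier of §2. The call of the J₃ twin of
`JET.Split.coreVertexExistenceX9_of_namedFacts` at `p = 3`. CONDITIONAL on the fact.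
[cite: McCallumLMS1991, §4 Prop. 4.4 (p. 301)] [cite: GrossLMS1991, Prop. 3.7 (2), §3 (pp. 238–239), §4 (4.1)]
[cite: Jetchev2008, Prop. 4.4 (p. 821)] [cite: Nekovar2007, Prop. 4.13 (ii)] -/
theorem exists_data_h47Base_of_frobeniusCongruence_of_discr_mod_eight_eq_one
    (h : GrossLMS1991.prop37_2_frobeniusCongruence)
    (W : WeierstrassCurve ℚ) [W.IsElliptic] [W.IsGloballyMinimal] [NeZero (W.conductorNorm ℤ)]
    {K : Type} [Field K] [NumberField K] (hK : IsImaginaryQuadratic K)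
    (hH : SatisfiesHeegnerHypothesis (W.conductorNorm ℤ) K)
    {p : ℕ} [Fact p.Prime] (hp2 : p ≠ 2) (hHp : SatisfiesHeegnerHypothesis p K)
    (hirr : W.HasIrreducibleModPGaloisRep p) (hd8 : NumberField.discr K % 8 = 1)
    (Dt : ModularParametrizationData W (W.conductorNorm ℤ)) (β : ℤ) (ι : K →+* ℂ) {k : ℕ} (hk : 1 ≤ k)
    {n : ℕ} (hn : Squarefree n ∧ ∀ q ∈ n.primeFactors,
      Zhang2014.IsKolyvaginPrime (W.conductorNorm ℤ) W K p q ∧ k ≤ Zhang2014.kolyvaginIndex W p q)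
    (d : KolyvaginHeegnerData Dt β ι n) :
    ∃ D : ∀ s : {m : ℕ // Squarefree m ∧ ∀ q ∈ m.primeFactors,
        Zhang2014.IsKolyvaginPrime (W.conductorNorm ℤ) W K p q ∧ k ≤ Zhang2014.kolyvaginIndex W p q},
        KolyvaginHeegnerData Dt β ι s.1, D ⟨n, hn⟩ = d ∧
      ∀ (s s' : {m : ℕ // Squarefree m ∧ ∀ q ∈ m.primeFactors,
        Zhang2014.IsKolyvaginPrime (W.conductorNorm ℤ) W K p q ∧ k ≤ Zhang2014.kolyvaginIndex W p q})
        (ℓ : ℕ), ℓ.Prime → ¬ ℓ ∣ s.1 → s'.1 = s.1 * ℓ → (∀ q ∈ s.1.primeFactors, q < ℓ) → n ∣ s.1 →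
      ∀ v : HeightOneSpectrum (𝓞 K), (ℓ : 𝓞 K) ∈ v.asIdeal →
      addOrderOf (galoisCohomology.localization ((W.baseChange K).torsionGaloisModule ((p ^ k : ℕ) : ℤ))
          (Sum.inr v) 1 ((D s').kolyvaginClass (Fact.out : p.Prime) k)) =
        addOrderOf (galoisCohomology.localization ((W.baseChange K).torsionGaloisModule ((p ^ k : ℕ) : ℤ))
          (Sum.inr v) 1 ((D s).kolyvaginClass (Fact.out : p.Prime) k)) :=
  exists_data_h47Base_of_congruence_of_irr W hK (discr_lt_neg_four_of_discr_mod_eight_eq_one hK hd8) hH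
    hp2 hHp hirr (congruenceW_of_frobeniusCongruence_of_discr_mod_eight_eq_one h hK hH hd8) Dt β ι hk hn d

/-! ### 4. The three any-pair consumers, `p = 3` allowed -/

/-- **McCallum Prop. 4.4 «in particular» for ANY two data, `E[p]` irreducible, `p` odd split in `K`,
`d_K ≡ 1 (mod 8)`, BY NAME of Gross Prop. 3.7 (2)**: at `λ ∋ ℓ`, for every `j`,
`p^j c_M(mℓ) ∈ Sel_λ ↔ p^j c_M(mℓ)_λ = 0` and `p^j c_M(mℓ)_λ = 0 ↔ p^j c_M(m)_λ = 0` (corner-p1's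
`localOrder_kolyvaginClass_mul_eq_of_frobeniusCongruence_of_irr`, `hp3 ↦ hd8`). CONDITIONAL on the fact.
[cite: McCallumLMS1991, §4 Prop. 4.4 (p. 301)] [cite: GrossLMS1991, Prop. 3.7 (2), §4 (4.1)] -/
theorem localOrder_kolyvaginClass_mul_eq_of_frobeniusCongruence_of_irr_of_discr_mod_eight_eq_one
    (h : GrossLMS1991.prop37_2_frobeniusCongruence) (hK : IsImaginaryQuadratic K)
    (hH : SatisfiesHeegnerHypothesis (W.conductorNorm ℤ) K) {p : ℕ} [Fact p.Prime] (hp2 : p ≠ 2)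
    (hHp : SatisfiesHeegnerHypothesis p K) (hirr : W.HasIrreducibleModPGaloisRep p)
    (hd8 : NumberField.discr K % 8 = 1)
    (Dt : ModularParametrizationData W (W.conductorNorm ℤ)) (β : ℤ) (ι : K →+* ℂ) (M : ℕ) (hM : 1 ≤ M)
    (m l : ℕ) (hsq : Squarefree (m * l)) (hl : l.Prime) (hlm : ¬ l ∣ m)
    (hS : ∀ l' ∈ (m * l).primeFactors, Zhang2014.IsKolyvaginPrime (W.conductorNorm ℤ) W K p l' ∧
      M ≤ Zhang2014.kolyvaginIndex W p l')
    (d : KolyvaginHeegnerData Dt β ι m) (d' : KolyvaginHeegnerData Dt β ι (m * l))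
    (v : HeightOneSpectrum (𝓞 K)) (hv : (l : 𝓞 K) ∈ v.asIdeal) (j : ℕ) :
    (((p ^ j : ℕ) : ℤ) • d'.kolyvaginClass (Fact.out : p.Prime) M ∈
        selmerLocalKer (W.baseChange K) (v.adicCompletion K) ((p ^ M : ℕ) : ℤ) ↔
      ((p ^ j : ℕ) : ℤ) • d'.kolyvaginClass (Fact.out : p.Prime) M ∈
        (W.baseChange K).torsionLocalKer (v.adicCompletion K) ((p ^ M : ℕ) : ℤ)) ∧
    (((p ^ j : ℕ) : ℤ) • d'.kolyvaginClass (Fact.out : p.Prime) M ∈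
        (W.baseChange K).torsionLocalKer (v.adicCompletion K) ((p ^ M : ℕ) : ℤ) ↔
      ((p ^ j : ℕ) : ℤ) • d.kolyvaginClass (Fact.out : p.Prime) M ∈
        (W.baseChange K).torsionLocalKer (v.adicCompletion K) ((p ^ M : ℕ) : ℤ)) := by
  have hD := discr_lt_neg_four_of_discr_mod_eight_eq_one hK hd8
  exact localOrder_kolyvaginClass_mul_eq_of_irr hK (by omega) (by omega) hH hp2 hHp hirr Dt β ι M hM m l
    hsq hl hlm hS d d'
    (fun d₁ d₀ _ hΔ φ₀ hφ₀ hle γ _ ↦ congruence_pair_of_frobeniusCongruence_of_discr_mod_eight_eq_one h hK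
      hH hd8 hsq hl (fun q hq ↦ (hS q hq).1) d₁ d₀ hΔ φ₀ hφ₀ hle γ) v hv j

/-- **The walk's `h47` for ANY two data, `d_K ≡ 1 (mod 8)`, BY NAME of Gross Prop. 3.7 (2)** —
`addOrderOf (loc_λ c_M(mℓ)) = addOrderOf (loc_λ c_M(m))`, `E[p]` irreducible, `p` odd split in `K`
(`p = 3` included). CONDITIONAL on the fact.
[cite: Jetchev2008, Prop. 4.4 (p. 821)] [cite: McCallumLMS1991, §4 Prop. 4.4 (p. 301)] [cite: GrossLMS1991, Prop. 3.7 (2)] -/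
theorem addOrderOf_localization_kolyvaginClass_mul_eq_of_frobeniusCongruence_of_irr_of_discr_mod_eight_eq_one
    (h : GrossLMS1991.prop37_2_frobeniusCongruence) (hK : IsImaginaryQuadratic K)
    (hH : SatisfiesHeegnerHypothesis (W.conductorNorm ℤ) K) {p : ℕ} [Fact p.Prime] (hp2 : p ≠ 2)
    (hHp : SatisfiesHeegnerHypothesis p K) (hirr : W.HasIrreducibleModPGaloisRep p)
    (hd8 : NumberField.discr K % 8 = 1)
    (Dt : ModularParametrizationData W (W.conductorNorm ℤ)) (β : ℤ) (ι : K →+* ℂ) (M : ℕ) (hM : 1 ≤ M)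
    (m l : ℕ) (hsq : Squarefree (m * l)) (hl : l.Prime) (hlm : ¬ l ∣ m)
    (hS : ∀ l' ∈ (m * l).primeFactors, Zhang2014.IsKolyvaginPrime (W.conductorNorm ℤ) W K p l' ∧
      M ≤ Zhang2014.kolyvaginIndex W p l')
    (d : KolyvaginHeegnerData Dt β ι m) (d' : KolyvaginHeegnerData Dt β ι (m * l))
    (v : HeightOneSpectrum (𝓞 K)) (hv : (l : 𝓞 K) ∈ v.asIdeal) :
    addOrderOf ((galoisCohomology.localization
        ((W.baseChange K).torsionGaloisModule ((p ^ M : ℕ) : ℤ)) (Sum.inr v) 1 :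
          galH1Torsion (W.baseChange K) ((p ^ M : ℕ) : ℤ) →+ _)
        (d'.kolyvaginClass (Fact.out : p.Prime) M)) =
      addOrderOf ((galoisCohomology.localization
        ((W.baseChange K).torsionGaloisModule ((p ^ M : ℕ) : ℤ)) (Sum.inr v) 1 :
          galH1Torsion (W.baseChange K) ((p ^ M : ℕ) : ℤ) →+ _)
        (d.kolyvaginClass (Fact.out : p.Prime) M)) := by
  have hD := discr_lt_neg_four_of_discr_mod_eight_eq_one hK hd8
  exact addOrderOf_localization_kolyvaginClass_mul_eq_of_irr hK (by omega) (by omega) hH hp2 hHp hirr Dt β ι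
    M hM m l hsq hl hlm hS d d'
    (fun d₁ d₀ _ hΔ φ₀ hφ₀ hle γ _ ↦ congruence_pair_of_frobeniusCongruence_of_discr_mod_eight_eq_one h hK
      hH hd8 hsq hl (fun q hq ↦ (hS q hq).1) d₁ d₀ hΔ φ₀ hφ₀ hle γ) v hv

/-- **The swap's `h44c` for ANY two data (`j = 0`), `d_K ≡ 1 (mod 8)`, BY NAME of Gross Prop. 3.7 (2)**
— `c_M(mℓ)_λ = 0 ↔ c_M(m)_λ = 0`, `E[p]` irreducible, `p` odd split in `K` (`p = 3` included).
CONDITIONAL on the fact. [cite: McCallumLMS1991, §4 Prop. 4.4 (p. 301)] [cite: GrossLMS1991, Prop. 6.2 (2), Prop. 3.7 (2)] -/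
theorem kolyvaginClass_mul_mem_torsionLocalKer_iff_of_frobeniusCongruence_of_irr_of_discr_mod_eight_eq_one
    (h : GrossLMS1991.prop37_2_frobeniusCongruence) (hK : IsImaginaryQuadratic K)
    (hH : SatisfiesHeegnerHypothesis (W.conductorNorm ℤ) K) {p : ℕ} [Fact p.Prime] (hp2 : p ≠ 2)
    (hHp : SatisfiesHeegnerHypothesis p K) (hirr : W.HasIrreducibleModPGaloisRep p)
    (hd8 : NumberField.discr K % 8 = 1)
    (Dt : ModularParametrizationData W (W.conductorNorm ℤ)) (β : ℤ) (ι : K →+* ℂ) (M : ℕ) (hM : 1 ≤ M)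
    (m l : ℕ) (hsq : Squarefree (m * l)) (hl : l.Prime) (hlm : ¬ l ∣ m)
    (hS : ∀ l' ∈ (m * l).primeFactors, Zhang2014.IsKolyvaginPrime (W.conductorNorm ℤ) W K p l' ∧
      M ≤ Zhang2014.kolyvaginIndex W p l')
    (d : KolyvaginHeegnerData Dt β ι m) (d' : KolyvaginHeegnerData Dt β ι (m * l))
    (v : HeightOneSpectrum (𝓞 K)) (hv : (l : 𝓞 K) ∈ v.asIdeal) :
    d'.kolyvaginClass (Fact.out : p.Prime) M ∈
        (W.baseChange K).torsionLocalKer (v.adicCompletion K) ((p ^ M : ℕ) : ℤ) ↔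
      d.kolyvaginClass (Fact.out : p.Prime) M ∈
        (W.baseChange K).torsionLocalKer (v.adicCompletion K) ((p ^ M : ℕ) : ℤ) := by
  have hD := discr_lt_neg_four_of_discr_mod_eight_eq_one hK hd8
  exact kolyvaginClass_mul_mem_torsionLocalKer_iff_of_irr hK (by omega) (by omega) hH hp2 hHp hirr Dt β ι
    M hM m l hsq hl hlm hS d d'
    (fun d₁ d₀ _ hΔ φ₀ hφ₀ hle γ _ ↦ congruence_pair_of_frobeniusCongruence_of_discr_mod_eight_eq_one h hK
      hH hd8 hsq hl (fun q hq ↦ (hS q hq).1) d₁ d₀ hΔ φ₀ hφ₀ hle γ) v hv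

end Summit.BirchSwinnertonDyer.BirchSwinnertonDyer.Theorems.Prop44

/-! ### 5. Leaf forms on class X10b (`p = 3`) -/

namespace Literature.NumberTheory.EllipticCurves.Rank1Residual

open Summit.BirchSwinnertonDyer.BirchSwinnertonDyer.Theorems

variable {W : WeierstrassCurve ℚ} [W.IsElliptic] [W.IsGloballyMinimal] [NeZero (W.conductorNorm ℤ)]
  {p : ℕ} [Fact p.Prime]

/-- **The based data family with Prop. 4.7 on an X10b Heegner frame of route `PrintX10b` rev 3b**
(`ClassX10 W p`, so `p = 3`, `E[3]` irreducible; `K` imaginary quadratic with the Heegner hypothesis for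
`N_E`, `3` split, `d_K ≡ 1 (mod 8)`), BY NAME of Gross Prop. 3.7 (2): the `h47` input of the J₃ twin of
p4's `coreVertexExistenceX9_of_namedFacts`. CONDITIONAL on the fact.
[cite: McCallumLMS1991, §4 Prop. 4.4 (p. 301)] [cite: GrossLMS1991, Prop. 3.7 (2)] [cite: Jetchev2008, Prop. 4.4 (p. 821)] -/
theorem ClassX10.exists_data_h47Base_of_heegner_of_discr_mod_eight_eq_one (hX : ClassX10 W p)
    (h37 : GrossLMS1991.prop37_2_frobeniusCongruence)
    {K : Type} [Field K] [NumberField K] (hK : IsImaginaryQuadratic K)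
    (hH : SatisfiesHeegnerHypothesis (W.conductorNorm ℤ) K) (hHp : SatisfiesHeegnerHypothesis p K)
    (hd8 : NumberField.discr K % 8 = 1)
    (Dt : ModularParametrizationData W (W.conductorNorm ℤ)) (β : ℤ) (ι : K →+* ℂ) {k : ℕ} (hk : 1 ≤ k)
    {n : ℕ} (hn : Squarefree n ∧ ∀ q ∈ n.primeFactors,
      Zhang2014.IsKolyvaginPrime (W.conductorNorm ℤ) W K p q ∧ k ≤ Zhang2014.kolyvaginIndex W p q)
    (d : KolyvaginHeegnerData Dt β ι n) :
    ∃ D : ∀ s : {m : ℕ // Squarefree m ∧ ∀ q ∈ m.primeFactors,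
        Zhang2014.IsKolyvaginPrime (W.conductorNorm ℤ) W K p q ∧ k ≤ Zhang2014.kolyvaginIndex W p q},
        KolyvaginHeegnerData Dt β ι s.1, D ⟨n, hn⟩ = d ∧
      ∀ (s s' : {m : ℕ // Squarefree m ∧ ∀ q ∈ m.primeFactors,
        Zhang2014.IsKolyvaginPrime (W.conductorNorm ℤ) W K p q ∧ k ≤ Zhang2014.kolyvaginIndex W p q})
        (ℓ : ℕ), ℓ.Prime → ¬ ℓ ∣ s.1 → s'.1 = s.1 * ℓ → (∀ q ∈ s.1.primeFactors, q < ℓ) → n ∣ s.1 →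
      ∀ v : HeightOneSpectrum (𝓞 K), (ℓ : 𝓞 K) ∈ v.asIdeal →
      addOrderOf (galoisCohomology.localization ((W.baseChange K).torsionGaloisModule ((p ^ k : ℕ) : ℤ))
          (Sum.inr v) 1 ((D s').kolyvaginClass (Fact.out : p.Prime) k)) =
        addOrderOf (galoisCohomology.localization ((W.baseChange K).torsionGaloisModule ((p ^ k : ℕ) : ℤ))
          (Sum.inr v) 1 ((D s).kolyvaginClass (Fact.out : p.Prime) k)) :=
  Prop44.exists_data_h47Base_of_frobeniusCongruence_of_discr_mod_eight_eq_one h37 W hK hH hX.ne_two hHp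
    hX.irr hd8 Dt β ι hk hn d

/-- **The walk's `h47` for ANY two data on an X10b Heegner frame of rev 3b** (`p = 3`, `d_K ≡ 1 (mod 8)`),
BY NAME of Gross Prop. 3.7 (2). CONDITIONAL on the fact.
[cite: Jetchev2008, Prop. 4.4 (p. 821)] [cite: McCallumLMS1991, §4 Prop. 4.4 (p. 301)] [cite: GrossLMS1991, Prop. 3.7 (2)] -/
theorem ClassX10.addOrderOf_localization_kolyvaginClass_mul_eq_of_heegner_of_discr_mod_eight_eq_one
    (hX : ClassX10 W p) (h37 : GrossLMS1991.prop37_2_frobeniusCongruence)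
    {K : Type} [Field K] [NumberField K] (hK : IsImaginaryQuadratic K)
    (hH : SatisfiesHeegnerHypothesis (W.conductorNorm ℤ) K) (hHp : SatisfiesHeegnerHypothesis p K)
    (hd8 : NumberField.discr K % 8 = 1)
    (Dt : ModularParametrizationData W (W.conductorNorm ℤ)) (β : ℤ) (ι : K →+* ℂ) (M : ℕ) (hM : 1 ≤ M)
    (m l : ℕ) (hsq : Squarefree (m * l)) (hl : l.Prime) (hlm : ¬ l ∣ m)
    (hS : ∀ l' ∈ (m * l).primeFactors, Zhang2014.IsKolyvaginPrime (W.conductorNorm ℤ) W K p l' ∧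
      M ≤ Zhang2014.kolyvaginIndex W p l')
    (d : KolyvaginHeegnerData Dt β ι m) (d' : KolyvaginHeegnerData Dt β ι (m * l))
    (v : HeightOneSpectrum (𝓞 K)) (hv : (l : 𝓞 K) ∈ v.asIdeal) :
    addOrderOf ((galoisCohomology.localization
        ((W.baseChange K).torsionGaloisModule ((p ^ M : ℕ) : ℤ)) (Sum.inr v) 1 :
          galH1Torsion (W.baseChange K) ((p ^ M : ℕ) : ℤ) →+ _)
        (d'.kolyvaginClass (Fact.out : p.Prime) M)) =
      addOrderOf ((galoisCohomology.localization
        ((W.baseChange K).torsionGaloisModule ((p ^ M : ℕ) : ℤ)) (Sum.inr v) 1 :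
          galH1Torsion (W.baseChange K) ((p ^ M : ℕ) : ℤ) →+ _)
        (d.kolyvaginClass (Fact.out : p.Prime) M)) :=
  Prop44.addOrderOf_localization_kolyvaginClass_mul_eq_of_frobeniusCongruence_of_irr_of_discr_mod_eight_eq_one
    h37 hK hH hX.ne_two hHp hX.irr hd8 Dt β ι M hM m l hsq hl hlm hS d d' v hv

end Literature.NumberTheory.EllipticCurves.Rank1Residual

end
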